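import Literature.AlgebraicGeometry.AbelianSchemes.LDeltaCubeLocus
import Literature.AlgebraicGeometry.AbelianSchemes.AbelianSchemeLDeltaFibreH1Vanishing
import Literature.AlgebraicGeometry.AbelianSchemes.AbelianSchemeLDeltaFibreH0Rank
import Literature.AlgebraicGeometry.Modules.CompleteLinearSystemLocus
import Literature.AlgebraicGeometry.Morphisms.SectionsRankOfFibreVanishing
import Literature.AlgebraicGeometry.Modules.PushforwardInjectiveResolution
import Literature.AlgebraicGeometry.Modules.CechPicOfLocalRing
import Literature.AlgebraicGeometry.Morphisms.QuasiCompactPushforwardCoh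
import HarnessLib

/-!
# The (V)→(VI) junction of [MumfordFogartyKirwan1994] Prop. 7.3: over the `L^Δ`-cube locus, `𝒪(1)|_A` has the fibrewise
# `H¹ = 0` and `h⁰ = 6^g·d` of `L^Δ(λ)^{⊗3}`, so «the embedding is the complete linear system» is an OPEN condition

Layer `Literature/AlgebraicGeometry/AbelianSchemes`, namespace `Literature.AlgebraicGeometry.AbelianSchemes.AbelianSchemeOver`.
THEOREMS ONLY (no definition, no named fact, no instance, no notation, no `sorry`).  Cell `hodgecm-mathlib` (D-0151), F-DAG row
F-6, tower segment (c) = the JUNCTION between step (V) (★ (γ) `LDeltaCubeLocus`, B-p08 (g12)) and step (VI) (★ FILE C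
`Modules/CompleteLinearSystemLocus` ed. 2, B-p06 (g12) / B-p04 (g20)); author B-p17 (g13) (B-plan1 (g16) 2026-08-30T08:31:48Z,
census `B-provers/B-p17/g13/CENSUS-F6-V-VI-Junction.B-p17g13.md`, sockets of record B-p04 (g20) 08:32:58Z).  Universe `0`
throughout (forced by the (VI) socket, ★ V4 and ★ R3).  HC_CM is proved only modulo the 7 printed citations until rung 0 closes;
nothing here is about HC, and the F-3 datum `D : A.DualPair` stays a hypothesis.

THE PRINT ([MumfordFogartyKirwan1994] Ch. 7 §2, proof of Prop. 7.3, p. 134): after step (V) («`L′₅ ≅ L^Δ(ω̄₅)³`», `Z₅` polarized by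
`ω̄₅`), step (VI) forms `(∗̃) : H⁰(𝒪_{ℙ_m}(1)) ⊗ M⁻¹ → π_*(L^Δ(ω̄₅)³)` (`M = ε^*L₅`) and puts «`H₆` equal to the open subset of `H₅`
where the kernel and cokernel of `(∗̃)` vanish».  Since `L′₅ = L₅ ⊗ π^*M⁻¹`, `(∗̃)` is `(𝒪^{m+1} → π_*L₅) ⊗ M⁻¹` (projection formula),
so its iso-locus is that of the UNTWISTED frame `u : 𝒪^{m+1} → π_*L₅` of `L₅ = 𝒪(1)|_{Z₅}`; the tree's (VI) socket ★
`Modules.exists_opens_forall_exists_comp_ι_iff_isIso_comp_pushforwardBaseChangeHom_of_forall_fieldPoint` represents that iso-locus by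
an OPEN subscheme as soon as `π : A_T → T` is proper flat, `G := 𝒪(1)|_{A_T}` is a line bundle, and at EVERY FIELD POINT of `T`
(i) `H¹(A_t, G_t) = 0` and (ii) `h⁰(A_t, G_t) = m + 1 = 6^g·d`.  This file discharges (i) and (ii) over the (V)-locus from the
polarisation `λ` with `𝒪(1)′|_{A_T} ≅ L^Δ_T(λ)^{⊗3}` — ★ V4 `Polarization.subsingleton_ext_one_pullback_LDelta_tensorPow'` ([MumfordAV1970]
§16) and ★ R3 `Polarization.finrank_secMod_pullback_LDelta_tensorPow` ([MumfordFogartyKirwan1994] Prop. 6.13) — after removing, on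
each fibre, the twist `π^*(ε^*L₀)^∨` by which the normalised `L′ = L₀ ⊗ π^*(ε^*L₀)^∨` of (V) differs from `L₀ = 𝒪(1)|_A`.

SETTING ((γ)'s letters verbatim).  `S : Scheme.{0}` (the (IV)-stage base `H₄`), `A : AbelianSchemeOver S`, `D : A.DualPair`,
`L₀ : A.left.Modules` of rank one (= `L₄ = 𝒪(1)|_{Z₄}`); over `b : T ⟶ S`: `A_T = A.baseChange b` (`pr : A_T → A`, `p_T : A_T → T`),
a POLARISATION `pol` of `(A_T, D.baseChange b)` (the (V)-closer ★-soon `PolarizationOfLDeltaCubeLocus` of B-p03 (g18) produces it at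
`b = j : H₅ ↪ H₄` with `pol.lam = ω₅`), its graph `Γ₁ = (pr, pol.lam ≫ pr_Â) : A_T → A ×_S Â` (two projections) and the (V)-iso
`e : pr^*L′ ≅ (Γ₁^*𝒫)^{⊗3}` (= the `∃`-clause of ★ (γ) `exists_isClosedImmersion_iff_existsUnique_LDelta_cube` with `ω := pol.lam`).
Write `G := pr^*L₀` («`𝒪(1)|_{A_T}`»).  Field points of `T` in the G10 / FILE C letter: `x : Spec K ⟶ T` (ANY field `K`) and ANY
cartesian square `(i : X₀ ⟶ A_T, f₀ : X₀ ⟶ Spec K)` over `x`.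

* §1 **`nonempty_pullback_iso_pullback_graph_tensorPow_of_LDelta_cube`** — on every such fibre `X₀`, `i^*G ≅ i^*(L^Δ_T(λ)^{⊗3})`
  where `L^Δ_T(λ) = Gr^*𝒫_T` for the `T`-graph `Gr = (1, λ) : A_T → A_T ×_T Â_T` (★ V4/R3 letter): `Γ₁ = Gr ≫ (A_T ×_T Â_T → A ×_S Â)`
  (★ B3d §1 pattern), and the twist `p_T^*(b^*(ε^*L₀)^∨)` restricted to `X₀` is `f₀^*` of a class on `Spec K`, which is `1`
  (★ `CechPic.eq_one_of_isLocalRing`); rank-one modules with equal classes are isomorphic (★ `nonempty_iso_iff_detClass_eq`).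
* §2 **`subsingleton_ext_one_pullback_of_LDelta_cube`** (`H¹(X₀, i^*G) = 0`, ★ V4 + §1 + ★ `subsingleton_ext_of_iso`) and
  **`finrank_secMod_pullback_of_LDelta_cube`** (`h⁰(X₀, i^*G) = 6^g · polarizationDegree δ` for `pol` of type `δ`, `char K = 0`;
  ★ R3 + §1 + ★ `exists_secMod_linearEquiv_of_iso`) — the (VI) socket's `hvan` / `hrank` letters VERBATIM at `G`;
  `charZero_of_hom_spec` (a field mapping to a `ℚ`-scheme has characteristic `0`).
* §3 HEAD **`exists_opens_iff_isIso_comp_pushforwardBaseChangeHom_of_LDelta_cube`** — for `T` locally Noetherian ℚ-scheme,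
  `A` of relative dimension `g`, `pol` of type `δ` and ANY frame `u : 𝒪_T^{6^g·d} → (p_T)_*G` (the `m+1` coordinate sections): there
  is an OPEN `U ⊆ T` such that `c : T′ → T` factors through `U` iff `c^*u ≫ β_H : 𝒪_{T′}^{6^g·d} → (p_{T′})_*(G_{T′})` is an
  isomorphism for any cartesian `H` over `c` — ★ FILE C ed. 2 instantiated (`IsProper`/`Flat` from the abelian scheme, `hL` from
  rank one, `hvan`/`hrank` from §2, and the affine-localizing hypothesis of `(p_T)_*G` DISCHARGED by ★ B-p09 (g15)
  `isAffineLocalizing_pushforward_of_isFiniteLocallyFree` — no `CompactSpace`/`hN` binder remains).  At `b = j`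
  this is «`H₆ ⊂ H₅` is open; `T → H₅` factors through `H₆` iff the restricted coordinate sections frame `π_*(𝒪(1)|_{A_T})`», i.e.
  MFK's linear rigidification inducing the given embedding (the packaging with ★ (γ) §4 is one `obtain` in the tower file).

## References
* [MumfordFogartyKirwan1994] D. Mumford, J. Fogarty, F. Kirwan, *Geometric Invariant Theory*, 3rd ed. (1994), Ch. 7 §2 Prop. 7.3
  (pp. 132–134), steps (V)–(VI) of the proof (p. 134); Ch. 6 §2 Prop. 6.13 (p. 123).
* [MumfordAV1970] D. Mumford, *Abelian Varieties* (1970), §16 (the vanishing theorem).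
* [Hartshorne1977] R. Hartshorne, *Algebraic Geometry* (1977), II Ex. 6.8, III Ex. 4.5.
* [GortzWedhorn2020] U. Görtz, T. Wedhorn, *Algebraic Geometry I*, 2nd ed. (2020), Section (4.7) (pp. 107–108).
-/

-- `Scheme.Modules` / `SheafOfModules` are not reducible (as in Mathlib's `AlgebraicGeometry/Modules/Sheaf.lean`).
set_option backward.isDefEq.respectTransparency false

noncomputable section

open CategoryTheory CategoryTheory.Limits AlgebraicGeometry MonoidalCategory CartesianMonoidalCategory
open CategoryTheory.Abelian
open scoped MonObj

namespace Literature.AlgebraicGeometry.AbelianSchemes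

open Literature.AlgebraicGeometry.Motives Literature.AlgebraicGeometry.Modules
  Literature.AlgebraicGeometry.AbelianVarieties Literature.AlgebraicGeometry.Morphisms
  Literature.AlgebraicGeometry.ModuliOfAbelianVarieties

namespace AbelianSchemeOver

variable {S : Scheme.{0}} (A : AbelianSchemeOver S) (D : A.DualPair) (L₀ : A.left.Modules) (hL₀ : HasRank L₀ 1)
  {T : Scheme.{0}} (b : T ⟶ S) (pol : (A.baseChange b).Polarization (D.baseChange b))
  (Γ₁ : (A.baseChange b).left ⟶ A.prodLeft D.hat)
  (hΓ₁₁ : Γ₁ ≫ pullback.fst A.X.hom D.hat.X.hom = pullback.fst A.X.hom b)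
  (hΓ₁₂ : Γ₁ ≫ pullback.snd A.X.hom D.hat.X.hom = pol.lam.left ≫ pullback.fst D.hat.X.hom b)
  (e : Nonempty ((Scheme.Modules.pullback (pullback.fst A.X.hom b)).obj
      (tensorObj L₀ ((Scheme.Modules.pullback A.X.hom).obj
        (Modules.dual ((Scheme.Modules.pullback A.unitSection).obj L₀)))) ≅
    tensorPow ((Scheme.Modules.pullback Γ₁).obj D.P) 3))

/-! ## §1 On every field-point fibre, `𝒪(1)|_{A_T} ≅ L^Δ_T(λ)^{⊗3}` -/

include hL₀ hΓ₁₁ hΓ₁₂ e in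
/-- **On every field-point fibre `X₀` of `A_T → T`, `i^*(pr^*L₀) ≅ i^*((Gr^*𝒫_T)^{⊗3})`** for the `T`-graph `Gr = (1, λ)` of the
polarisation (`Γ₁ = Gr ≫ (A_T ×_T Â_T → A ×_S Â)`): in `Ȟ¹(X₀, 𝒪^×)` both sides have class `i^*pr^*[L₀]`, because the (V)-iso gives
`pr^*[L′] = [Γ₁^*𝒫]³ = [Gr^*𝒫_T]³` with `[L′] = [L₀]·π^*[ε^*L₀]⁻¹`, and `i^*pr^*π^*[ε^*L₀] = f₀^*((x ≫ b)^*[ε^*L₀])` is the pull-back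
of a class on `Spec K`, trivial (★ `CechPic.eq_one_of_isLocalRing`); rank-one modules with equal classes are isomorphic.
[cite: MumfordFogartyKirwan1994, Ch. 7 §2 Proposition 7.3 (pp. 132–134)] [cite: Hartshorne1977, III Ex. 4.5] -/
theorem nonempty_pullback_iso_pullback_graph_tensorPow_of_LDelta_cube
    (Gr : (A.baseChange b).X.left ⟶ (A.baseChange b).prodLeft (D.hatBaseChange b))
    (hGr₁ : Gr ≫ pullback.fst (A.baseChange b).X.hom (D.hatBaseChange b).X.hom = 𝟙 _)
    (hGr₂ : Gr ≫ pullback.snd (A.baseChange b).X.hom (D.hatBaseChange b).X.hom = pol.lam.left)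
    {K : Type} [Field K] (x : Spec (.of K) ⟶ T) {X₀ : Scheme.{0}} {i : X₀ ⟶ (A.baseChange b).X.left}
    {f₀ : X₀ ⟶ Spec (.of K)} (H : IsPullback i f₀ (A.baseChange b).X.hom x) :
    Nonempty ((Scheme.Modules.pullback i).obj ((Scheme.Modules.pullback (pullback.fst A.X.hom b)).obj L₀) ≅
      (Scheme.Modules.pullback i).obj (tensorPow ((Scheme.Modules.pullback Gr).obj (D.baseChange b).P) 3)) := by
  obtain ⟨e⟩ := e
  have hP : IsFiniteLocallyFree D.P := HasRank.isFiniteLocallyFree' D.hasRank_one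
  -- `Γ₁ = Gr ≫ (A_T ×_T Â_T → A ×_S Â)` and `Gr^*𝒫_T ≅ Γ₁^*𝒫`
  have hΓ : Γ₁ = Gr ≫ D.prodBaseChangeToProd b := by
    apply pullback.hom_ext
    · rw [hΓ₁₁, Category.assoc, D.prodBaseChangeToProd_fst, ← Category.assoc, hGr₁, Category.id_comp]
    · rw [hΓ₁₂, Category.assoc, D.prodBaseChangeToProd_snd, ← Category.assoc, hGr₂]
  have c₀ : (Scheme.Modules.pullback Gr).obj (D.baseChange b).P ≅ (Scheme.Modules.pullback Γ₁).obj D.P :=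
    (Scheme.Modules.pullbackComp Gr (D.prodBaseChangeToProd b)).app D.P ≪≫
      (Scheme.Modules.pullbackCongr hΓ.symm).app D.P
  -- ranks and local-freeness witnesses
  have hG : HasRank ((Scheme.Modules.pullback (X := (A.baseChange b).X.left) (pullback.fst A.X.hom b)).obj L₀) 1 :=
    hasRank_pullback _ hL₀
  have hGi : HasRank ((Scheme.Modules.pullback i).obj
      ((Scheme.Modules.pullback (X := (A.baseChange b).X.left) (pullback.fst A.X.hom b)).obj L₀)) 1 :=
    hasRank_pullback _ hG
  have hM : HasRank ((Scheme.Modules.pullback Gr).obj (D.baseChange b).P) 1 :=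
    hasRank_pullback _ (D.baseChange b).hasRank_one
  have hM3 : HasRank (tensorPow ((Scheme.Modules.pullback Gr).obj (D.baseChange b).P) 3) 1 := hasRank_tensorPow_one hM 3
  have hM3i : HasRank ((Scheme.Modules.pullback i).obj
      (tensorPow ((Scheme.Modules.pullback Gr).obj (D.baseChange b).P) 3)) 1 := hasRank_pullback _ hM3
  have hΓP : HasRank ((Scheme.Modules.pullback Γ₁).obj D.P) 1 := hasRank_pullback _ D.hasRank_one
  have hΓP3 : HasRank (tensorPow ((Scheme.Modules.pullback Γ₁).obj D.P) 3) 1 := hasRank_tensorPow_one hΓP 3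
  have hεL : HasRank ((Scheme.Modules.pullback A.unitSection).obj L₀) 1 := hasRank_pullback _ hL₀
  have hQd : HasRank (Modules.dual ((Scheme.Modules.pullback A.unitSection).obj L₀)) 1 := hasRank_dual hεL
  have hQ : HasRank ((Scheme.Modules.pullback A.X.hom).obj
      (Modules.dual ((Scheme.Modules.pullback A.unitSection).obj L₀))) 1 := hasRank_pullback _ hQd
  have hL' := A.hasRank_normalised L₀ hL₀
  let fG := HasRank.isFiniteLocallyFree' hG
  let fGi := HasRank.isFiniteLocallyFree' hGi
  let fM := HasRank.isFiniteLocallyFree' hM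
  let fM3 := HasRank.isFiniteLocallyFree' hM3
  let fM3i := HasRank.isFiniteLocallyFree' hM3i
  let fΓP := HasRank.isFiniteLocallyFree' hΓP
  let fΓP3 := HasRank.isFiniteLocallyFree' hΓP3
  let fL₀ := HasRank.isFiniteLocallyFree' hL₀
  let fεL := HasRank.isFiniteLocallyFree' hεL
  let fQd := HasRank.isFiniteLocallyFree' hQd
  let fQ := HasRank.isFiniteLocallyFree' hQ
  let fL' := HasRank.isFiniteLocallyFree' hL'
  -- (1) the class of `i^*pr^*L₀`
  have h1 : detClass fGi = CechPic.pullback i (CechPic.pullback (pullback.fst A.X.hom b) (detClass fL₀)) :=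
    (detClass_eq_of_iso (Iso.refl _) fGi (fG.pullback i)).trans ((detClass_pullback i fG).trans
      (congrArg (CechPic.pullback i) ((detClass_eq_of_iso (Iso.refl _) fG (fL₀.pullback _)).trans
        (detClass_pullback _ fL₀))))
  -- (2) the class of `i^*(Gr^*𝒫_T)^{⊗3}`
  have h2 : detClass fM3i = CechPic.pullback i (CechPic.pullback Γ₁ (detClass hP) ^ 3) := by
    rw [(detClass_eq_of_iso (Iso.refl _) fM3i (fM3.pullback i)).trans (detClass_pullback i fM3),
      detClass_tensorPow hM fM 3 fM3, detClass_eq_of_iso c₀ fM fΓP,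
      (detClass_eq_of_iso (Iso.refl _) fΓP (hP.pullback Γ₁)).trans (detClass_pullback Γ₁ hP)]
  -- (3) the (V)-iso in classes: `pr^*[L′] = [Γ₁^*𝒫]³`
  have h3 : CechPic.pullback (pullback.fst A.X.hom b) (detClass fL') = CechPic.pullback Γ₁ (detClass hP) ^ 3 := by
    rw [← detClass_pullback _ fL', detClass_eq_of_iso e (fL'.pullback _) fΓP3, detClass_tensorPow hΓP fΓP 3 fΓP3,
      (detClass_eq_of_iso (Iso.refl _) fΓP (hP.pullback Γ₁)).trans (detClass_pullback Γ₁ hP)]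
  -- (4) `[L′] = [L₀] · (π^*ε^*[L₀])⁻¹`
  have h4 : detClass fL' = detClass fL₀ *
      (CechPic.pullback A.X.hom (CechPic.pullback A.unitSection (detClass fL₀)))⁻¹ := by
    rw [detClass_tensorObj_of_hasRank_one hL₀ hQ fL₀ fQ fL',
      (detClass_eq_of_iso (Iso.refl _) fQ (fQd.pullback A.X.hom)).trans (detClass_pullback A.X.hom fQd),
      detClass_dual' fεL fQd, (detClass_eq_of_iso (Iso.refl _) fεL (fL₀.pullback A.unitSection)).trans
        (detClass_pullback A.unitSection fL₀), map_inv]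
  -- (5) the twist dies on the fibre: it is pulled back from `Spec K`
  have hw : i ≫ pullback.snd A.X.hom b = f₀ ≫ x := H.w
  have hcomp : (i ≫ pullback.fst A.X.hom b) ≫ A.X.hom = f₀ ≫ (x ≫ b) :=
    (Category.assoc _ _ _).trans (((congrArg (i ≫ ·) (pullback.condition (f := A.X.hom) (g := b))).trans
      (Category.assoc _ _ _).symm).trans ((congrArg (· ≫ b) hw).trans (Category.assoc _ _ _)))
  have h5 : CechPic.pullback i (CechPic.pullback (pullback.fst A.X.hom b)
      (CechPic.pullback A.X.hom (CechPic.pullback A.unitSection (detClass fL₀)))) = 1 :=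
    calc CechPic.pullback i (CechPic.pullback (pullback.fst A.X.hom b)
          (CechPic.pullback A.X.hom (CechPic.pullback A.unitSection (detClass fL₀))))
        = CechPic.pullback ((i ≫ pullback.fst A.X.hom b) ≫ A.X.hom)
            (CechPic.pullback A.unitSection (detClass fL₀)) :=
          ((CechPic.pullback_comp (i ≫ pullback.fst A.X.hom b) A.X.hom _).trans
            (CechPic.pullback_comp i (pullback.fst A.X.hom b) _)).symm
      _ = CechPic.pullback (f₀ ≫ (x ≫ b)) (CechPic.pullback A.unitSection (detClass fL₀)) :=
          congrArg (CechPic.pullback · (CechPic.pullback A.unitSection (detClass fL₀))) hcomp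
      _ = CechPic.pullback f₀ (CechPic.pullback (x ≫ b) (CechPic.pullback A.unitSection (detClass fL₀))) :=
          CechPic.pullback_comp f₀ (x ≫ b) _
      _ = 1 := by
          rw [CechPic.eq_one_of_isLocalRing (CechPic.pullback (x ≫ b) (CechPic.pullback A.unitSection (detClass fL₀))),
            map_one]
  -- (6) assemble
  refine (nonempty_iso_iff_detClass_eq hGi hM3i fGi fM3i).2 ?_
  rw [h1, h2, ← h3, h4, map_mul, map_inv, map_mul, map_inv, h5, inv_one, mul_one]

/-! ## §2 `hvan` and `hrank` for `𝒪(1)|_{A_T}` over the (V)-locus -/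

include hL₀ hΓ₁₁ hΓ₁₂ e in
/-- **`H¹(X₀, i^*(𝒪(1)|_{A_T})) = 0` on every field-point fibre over the (V)-locus** — the (VI) socket's `hvan` letter VERBATIM at
`G = pr^*L₀`: ★ V4 `Polarization.subsingleton_ext_one_pullback_LDelta_tensorPow'` ([MumfordAV1970] §16 for `L^Δ(λ)^{⊗3}` with `λ`
a polarisation) moved along §1. [cite: MumfordAV1970, §16 (the vanishing theorem)]
[cite: MumfordFogartyKirwan1994, Ch. 7 §2 Prop. 7.3, step (VI) of the proof (p. 134)] -/
theorem subsingleton_ext_one_pullback_of_LDelta_cube {K : Type} [Field K] (x : Spec (.of K) ⟶ T) {X₀ : Scheme.{0}}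
    {i : X₀ ⟶ (A.baseChange b).X.left} {f₀ : X₀ ⟶ Spec (.of K)} (H : IsPullback i f₀ (A.baseChange b).X.hom x) :
    Subsingleton (Ext.{1} (unitModule X₀)
      ((Scheme.Modules.pullback i).obj ((Scheme.Modules.pullback (pullback.fst A.X.hom b)).obj L₀)) 1) := by
  -- the graph of `λ` over `T`
  let Gr : (A.baseChange b).X.left ⟶ (A.baseChange b).prodLeft (D.hatBaseChange b) :=
    pullback.lift (𝟙 _) pol.lam.left (by rw [Category.id_comp]; exact (Over.w pol.lam).symm)
  have hGr₁ : Gr ≫ pullback.fst (A.baseChange b).X.hom (D.hatBaseChange b).X.hom = 𝟙 _ := pullback.lift_fst _ _ _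
  have hGr₂ : Gr ≫ pullback.snd (A.baseChange b).X.hom (D.hatBaseChange b).X.hom = pol.lam.left := pullback.lift_snd _ _ _
  obtain ⟨φ⟩ := A.nonempty_pullback_iso_pullback_graph_tensorPow_of_LDelta_cube D L₀ hL₀ b pol Γ₁ hΓ₁₁ hΓ₁₂ e
    Gr hGr₁ hGr₂ x H
  haveI := pol.subsingleton_ext_one_pullback_LDelta_tensorPow' (A.baseChange b) (D.baseChange b) Gr hGr₁ hGr₂ x H
    (m := 3) (by norm_num)
  exact Modules.subsingleton_ext_of_iso (unitModule X₀) φ 1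

include hL₀ hΓ₁₁ hΓ₁₂ e in
/-- **`h⁰(X₀, i^*(𝒪(1)|_{A_T})) = 6^g · deg δ` on every field-point fibre of characteristic `0` over the (V)-locus**, for `A` of
relative dimension `g` and `pol` of type `δ` — the (VI) socket's `hrank` letter VERBATIM at `G = pr^*L₀` with `r := 6^g · polarizationDegree δ`
(`= m + 1` for the Hilbert-scheme embedding): ★ R3 `Polarization.finrank_secMod_pullback_LDelta_tensorPow` ([MumfordFogartyKirwan1994]
Prop. 6.13 / [MumfordAV1970] §16 Riemann–Roch for `L^Δ(λ)^{⊗3}`) moved along §1 (★ `exists_secMod_linearEquiv_of_iso`).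
[cite: MumfordFogartyKirwan1994, Ch. 6 §2 Prop. 6.13 (p. 123)] [cite: MumfordFogartyKirwan1994, Ch. 7 §2 Prop. 7.3, step (VI) of the proof (p. 134)] -/
theorem finrank_secMod_pullback_of_LDelta_cube {g : ℕ} (hg : A.IsOfRelDim g) {δ : Fin g → ℕ} (hT : pol.HasType δ)
    {K : Type} [Field K] [CharZero K] (x : Spec (.of K) ⟶ T) {X₀ : Scheme.{0}}
    {i : X₀ ⟶ (A.baseChange b).X.left} {f₀ : X₀ ⟶ Spec (.of K)} (H : IsPullback i f₀ (A.baseChange b).X.hom x) :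
    Module.finrank Γ(Spec (.of K), ⊤)
        (SecMod ((Scheme.Modules.pullback i).obj ((Scheme.Modules.pullback (pullback.fst A.X.hom b)).obj L₀))
          f₀.appTop.hom ⊤) = 6 ^ g * polarizationDegree δ := by
  let Gr : (A.baseChange b).X.left ⟶ (A.baseChange b).prodLeft (D.hatBaseChange b) :=
    pullback.lift (𝟙 _) pol.lam.left (by rw [Category.id_comp]; exact (Over.w pol.lam).symm)
  have hGr₁ : Gr ≫ pullback.fst (A.baseChange b).X.hom (D.hatBaseChange b).X.hom = 𝟙 _ := pullback.lift_fst _ _ _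
  have hGr₂ : Gr ≫ pullback.snd (A.baseChange b).X.hom (D.hatBaseChange b).X.hom = pol.lam.left := pullback.lift_snd _ _ _
  obtain ⟨φ⟩ := A.nonempty_pullback_iso_pullback_graph_tensorPow_of_LDelta_cube D L₀ hL₀ b pol Γ₁ hΓ₁₁ hΓ₁₂ e
    Gr hGr₁ hGr₂ x H
  obtain ⟨Lφ, -⟩ := exists_secMod_linearEquiv_of_iso f₀.appTop.hom φ
  rw [Lφ.finrank_eq, pol.finrank_secMod_pullback_LDelta_tensorPow (A.baseChange b) (D.baseChange b) (hg.baseChange b) hT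
    Gr hGr₁ hGr₂ x H (m := 3) (by norm_num)]

/-- **A field mapping to a `ℚ`-scheme has characteristic zero**: if every non-zero integer is non-zero in the residue fields of
`T` and `x : Spec K → T`, then `char K = 0` (`x` factors through `Spec κ(x(pt)) → T` and `κ(x(pt)) → K` is injective).
[cite: GortzWedhorn2020, Section (4.7) (pp. 107–108)] -/
theorem charZero_of_hom_spec (hQ : ∀ M : ℕ, M ≠ 0 → ∀ t : T, (M : T.residueField t) ≠ 0)
    {K : Type} [Field K] (x : Spec (.of K) ⟶ T) : CharZero K := by
  obtain ⟨t, φ⟩ := Scheme.SpecToEquivOfField K T x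
  refine charZero_of_inj_zero fun n hn => ?_
  by_contra h
  apply hQ n h t
  apply φ.hom.injective
  rw [map_natCast, map_zero]
  exact hn

/-! ## §3 HEAD: «the embedding is the complete linear system» is an OPEN condition over the (V)-locus -/

include hL₀ hΓ₁₁ hΓ₁₂ e in
/-- **[MumfordFogartyKirwan1994] Prop. 7.3 step (VI) over the (V)-locus.**  `T` a locally Noetherian `ℚ`-scheme (`hQ`), `A/S` of
relative dimension `g`, `b : T → S`, `pol` a polarisation of `A_T` of type `δ` with graph `Γ₁` and `pr^*L′ ≅ (Γ₁^*𝒫)^{⊗3}` (the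
(V)-data), `G = pr^*L₀ = 𝒪(1)|_{A_T}`, and ANY frame `u : 𝒪_T^{6^g·deg δ} → (p_T)_*G` (e.g. the `m + 1` coordinate sections): THERE IS
AN OPEN `U ⊆ T` such that for every `c : T′ → T` and every cartesian square `H` of `p_T` along `c`, `c` factors through `U` iff
`c^*u ≫ β_H : 𝒪_{T′}^{6^g·deg δ} → (p_{T′})_*(G_{T′})` is an isomorphism («the restricted coordinate sections frame the sections of
`𝒪(1)` on `A_{T′}`» = a linear rigidification inducing the given embedding).  ★ FILE C ed. 2
`exists_opens_forall_exists_comp_ι_iff_isIso_comp_pushforwardBaseChangeHom_of_forall_fieldPoint` with `p_T` proper (abelian scheme)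
and flat (smooth), `G` of rank one, `(p_T)_*G` affine-localizing (★ `isAffineLocalizing_pushforward_of_isFiniteLocallyFree`: `p_T`
quasi-compact of finite type, `A_T` locally Noetherian), `hvan`/`hrank` from §2.  MFK: «Put `H₆` equal to the open subset of `H₅`
where the kernel and cokernel of `(∗̃)` vanish». [cite: MumfordFogartyKirwan1994, Ch. 7 §2 Prop. 7.3, step (VI) of the proof (p. 134)]
[cite: MumfordFogartyKirwan1994, Ch. 7 §2 Proposition 7.3 (pp. 132–134)] -/
theorem exists_opens_iff_isIso_comp_pushforwardBaseChangeHom_of_LDelta_cube [IsLocallyNoetherian T]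
    {g : ℕ} (hg : A.IsOfRelDim g) (hQ : ∀ M : ℕ, M ≠ 0 → ∀ t : T, (M : T.residueField t) ≠ 0)
    {δ : Fin g → ℕ} (hT : pol.HasType δ)
    (u : freeModule T (Fin (6 ^ g * polarizationDegree δ)) ⟶
      (Scheme.Modules.pushforward (A.baseChange b).X.hom).obj ((Scheme.Modules.pullback (pullback.fst A.X.hom b)).obj L₀)) :
    ∃ U : T.Opens, ∀ {T' XT' : Scheme.{0}} (c : T' ⟶ T) {pr' : XT' ⟶ (A.baseChange b).X.left} {pT' : XT' ⟶ T'}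
      (H : IsPullback pr' pT' (A.baseChange b).X.hom c),
      (∃ c' : T' ⟶ (U : Scheme.{0}), c' ≫ U.ι = c) ↔
        IsIso ((Scheme.Modules.pullback c).map u ≫
          pushforwardBaseChangeHom H.w ((Scheme.Modules.pullback (pullback.fst A.X.hom b)).obj L₀)) := by
  haveI : IsProper (A.baseChange b).X.hom := (A.baseChange b).isProper
  haveI : Smooth (A.baseChange b).X.hom := (A.baseChange b).isSmooth
  haveI : Flat (A.baseChange b).X.hom := inferInstance
  haveI : IsLocallyNoetherian (A.baseChange b).X.left := LocallyOfFiniteType.isLocallyNoetherian (A.baseChange b).X.hom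
  have hL : IsFiniteLocallyFree ((Scheme.Modules.pullback (X := (A.baseChange b).X.left) (pullback.fst A.X.hom b)).obj L₀) :=
    HasRank.isFiniteLocallyFree' (hasRank_pullback _ hL₀)
  exact exists_opens_forall_exists_comp_ι_iff_isIso_comp_pushforwardBaseChangeHom_of_forall_fieldPoint
    ((Scheme.Modules.pullback (pullback.fst A.X.hom b)).obj L₀) hL
    (isAffineLocalizing_pushforward_of_isFiniteLocallyFree (A.baseChange b).X.hom hL)
    (6 ^ g * polarizationDegree δ)
    (fun K _ X₀ i f₀ x H => A.subsingleton_ext_one_pullback_of_LDelta_cube D L₀ hL₀ b pol Γ₁ hΓ₁₁ hΓ₁₂ e x H)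
    (fun K _ X₀ i f₀ x H => by
      haveI := charZero_of_hom_spec hQ x
      exact A.finrank_secMod_pullback_of_LDelta_cube D L₀ hL₀ b pol Γ₁ hΓ₁₁ hΓ₁₂ e hg hT x H)
    u

end AbelianSchemeOver

end Literature.AlgebraicGeometry.AbelianSchemes

end
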